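import Literature.Geometry.Kaehler.HolomorphicChainBlowUpMass
import Literature.Geometry.Kaehler.HolomorphicChainLelongNumber
import Literature.Geometry.Kaehler.HolomorphicChainRectifiableHolds
import HarnessLib

/-!
# The masses of the blow-ups of a holomorphic chain converge to its density

For a holomorphic `p`-chain `T = Σ kⱼ [Aⱼ]` (`p = q + 1`) on an open `Ω ⊆ V` and `b ∈ Ω`, the
masses of the blow-ups `D_r = (1/r)_*(τ_{-b})_*[T]` on the unit ball converge as `r → 0⁺`:

  `𝐌(D_r) = r^{-2p} ‖T‖(B(b,r)) ⟶ c(2p) · Σⱼ |kⱼ| n(Aⱼ, b)`,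

`c(2p)` the volume of the unit `2p`-ball and `n(Aⱼ, b)` the Lelong numbers of the components
through `b` — Harvey's description of the multiplicity of `T` at `b` as *"(4) the density (or
Lelong number) `Θ(T, z) = lim_{r→0} M(B(z,r) ∩ T) / (c r^{2p})`"* [Harvey1977, §1.9], read on the
blow-ups via the mass identity `𝐌_{B(0,1)}((1/r)_*(T)) = r^{-2p} 𝐌_{B(b,r)}(T)` [Harvey1977, §1.10]
(`HolomorphicChain.mass_blowUp_eq`) and the Lelong number of the mass of a chain
(`HolomorphicChain.tendsto_lintegral_enorm_density_div`, [Chirka1989, §15.1]).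

Theorems only; no new definitions, no named facts.

## References

* R. Harvey, *Holomorphic chains and their boundaries*, PSPUM XXX.1 (1977), §1.9 (4), §1.10
  [Harvey1977].
* E. M. Chirka, *Complex Analytic Sets*, Kluwer 1989, §15.1, p. 190 [Chirka1989].
-/

noncomputable section

open scoped Manifold Topology ENNReal
open Set Filter MeasureTheory Metric

namespace Literature.Geometry.Kaehler

open Literature.Geometry.GeometricMeasureTheory

universe u

variable {V : Type u} [NormedAddCommGroup V] [InnerProductSpace ℂ V] [FiniteDimensional ℂ V]
  [MeasurableSpace V] [BorelSpace V] {Ω : TopologicalSpace.Opens V} {q : ℕ}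

namespace HolomorphicChain

/-- **`𝐌(D_r) = ‖T‖(B(b,r)) / r^{2p}`**, unconditionally (`0 < r`, `B(b,r) ⊆ Ω`).
[cite: Harvey1977, §1.10] -/
theorem mass_blowUp_eq_div (T : HolomorphicChain 𝓘(ℂ, V) Ω (q + 1)) {b : V} {r : ℝ} (hr : 0 < r)
    (hball : ball b r ⊆ (Ω : Set V)) :
    (T.blowUp b r).mass = (∫⁻ x in T.carrier ∩ ball b r, ‖(T.density x : ℝ)‖ₑ
        ∂(μHE[2 * (q + 1)] : Measure V)) / ENNReal.ofReal (r ^ (2 * (q + 1))) := by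
  rw [T.mass_blowUp_eq (Harvey1977_isRectifiableData_toCurrent_holds V Ω (q + 1) T) hr hball,
    inv_pow, ENNReal.ofReal_inv_of_pos (pow_pos hr _), mul_comm, div_eq_mul_inv]

/-- **The masses of the blow-ups converge to the density of the chain**: for a holomorphic
`p`-chain `T` (`p = q + 1`) and `b ∈ Ω`,
`𝐌(D_r) → c(2p) · Σ_Z |k_Z| n(Z, b)` as `r → 0⁺` (`c(2p) = unitBallVolume (2p)`, the sum over the
components of `T`, finitely supported). [cite: Harvey1977, §1.9, §1.10; Chirka1989, §15.1, p. 190] -/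
theorem tendsto_mass_blowUp (T : HolomorphicChain 𝓘(ℂ, V) Ω (q + 1)) {b : V}
    (hb : b ∈ (Ω : Set V)) :
    Tendsto (fun r : ℝ => (T.blowUp b r).mass) (𝓝[>] (0 : ℝ))
      (𝓝 (unitBallVolume (2 * (q + 1)) *
        ∑ᶠ Z : Set Ω, ENNReal.ofReal |(T.mult Z : ℝ)| * lelongNumber Z (q + 1) b)) := by
  have hlim := T.tendsto_lintegral_enorm_density_div hb
  have hc0 : unitBallVolume (2 * (q + 1)) ≠ 0 := unitBallVolume_ne_zero _
  have hct : unitBallVolume (2 * (q + 1)) ≠ ⊤ := unitBallVolume_ne_top _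
  have h2 := ENNReal.Tendsto.const_mul hlim (Or.inr hct)
  obtain ⟨R, hR, hRΩ⟩ := Metric.isOpen_iff.1 Ω.isOpen b hb
  refine h2.congr' ?_
  filter_upwards [Ioo_mem_nhdsGT hR] with r hr
  have hballr : ball b r ⊆ (Ω : Set V) := (ball_subset_ball hr.2.le).trans hRΩ
  rw [T.mass_blowUp_eq_div hr.1 hballr]
  have hr0 : ENNReal.ofReal (r ^ (2 * (q + 1))) ≠ 0 := (ENNReal.ofReal_pos.2 (pow_pos hr.1 _)).ne'
  rw [← ENNReal.mul_div_mul_left (∫⁻ x in T.carrier ∩ ball b r, ‖(T.density x : ℝ)‖ₑ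
      ∂(μHE[2 * (q + 1)] : Measure V)) (ENNReal.ofReal (r ^ (2 * (q + 1)))) hc0 hct,
    mul_div_assoc]

/-- **For an analytic set**: the masses of the blow-ups of `[A]` at `b ∈ Ω` converge to
`c(2p) · n(A, b)` (pure dimension `p = q + 1`). [cite: Harvey1977, §1.9; Chirka1989, §15.1, p. 189] -/
theorem tendsto_mass_blowUp_ofSet {A : Set Ω} (hA : HasPureDim 𝓘(ℂ, V) A (q + 1)) {b : V}
    (hb : b ∈ (Ω : Set V)) :
    Tendsto (fun r : ℝ => ((ofSet A hA).blowUp b r).mass) (𝓝[>] (0 : ℝ))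
      (𝓝 (unitBallVolume (2 * (q + 1)) * lelongNumber A (q + 1) b)) := by
  have hlim := (tendsto_massRatio_lelongNumber hA hb)
  have hct : unitBallVolume (2 * (q + 1)) ≠ ⊤ := unitBallVolume_ne_top _
  have hc0 : unitBallVolume (2 * (q + 1)) ≠ 0 := unitBallVolume_ne_zero _
  have h2 := ENNReal.Tendsto.const_mul hlim (Or.inr hct)
  obtain ⟨R, hR, hRΩ⟩ := Metric.isOpen_iff.1 Ω.isOpen b hb
  refine h2.congr' ?_
  filter_upwards [Ioo_mem_nhdsGT hR] with r hr
  have hballr : ball b r ⊆ (Ω : Set V) := (ball_subset_ball hr.2.le).trans hRΩ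
  rw [(ofSet A hA).mass_blowUp_eq_div hr.1 hballr, massRatio_apply,
    measure_image_inter_eq_carrier_inter hA (ball b r)]
  -- `∫_{carrier ∩ B} ‖θ‖ₑ = μ(carrier ∩ B)` since `θ = 1` on the carrier
  have hint : ∫⁻ x in (ofSet A hA).carrier ∩ ball b r, ‖((ofSet A hA).density x : ℝ)‖ₑ
      ∂(μHE[2 * (q + 1)] : Measure V) =
      (μHE[2 * (q + 1)] : Measure V) ((ofSet A hA).carrier ∩ ball b r) := by
    rw [← setLIntegral_one]
    refine setLIntegral_congr_fun ((ofSet A hA).measurableSet_carrier.inter measurableSet_ball)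
      fun x hx => ?_
    rw [density_ofSet_of_mem_carrier hA hx.1]
    simp
  rw [hint, ← ENNReal.mul_div_mul_left ((μHE[2 * (q + 1)] : Measure V)
      ((ofSet A hA).carrier ∩ ball b r)) (ENNReal.ofReal (r ^ (2 * (q + 1)))) hc0 hct,
    mul_div_assoc]

end HolomorphicChain

end Literature.Geometry.Kaehler
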